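import Literature.Computability.Complexity.GateEliminationCase5Chain

/-!
# Gate elimination: Case 5.3 of Li–Yang's proof of Theorem 4.1

"If `C` feeds `D` and `D` feeds `B`, after substituting constant to `x`, we can eliminate `G`,
`D` and `B` in order. By normalization lemma, the only nodes that may become or feed troubled
gates are `y` and `C`, while none of them can be like that. Hence no troubled gate is
introduced" (ECCC TR21-023, §4.1, Case 5.3) — so the main strategy of Case 5 applies
(`case5_main`: `Δμ ≥ 3 + α_φ + α_I ≥ δ`). PROVED: `LiYang2022_case5_3_holds`. (Formally: a new
troubled gate after the elimination of `D` or of `B` would be `C`, which reads the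
`1`-variable `y`.)

## References

* J. Li, T. Yang, *3.1n − o(n) circuit lower bounds for explicit functions*, STOC 2022;
  ECCC TR21-023, §4.1 (Case 5.3), Lemma 3.11.
-/

namespace Literature.Computability.Complexity

open Finset
open Semicircuit

/-- **Case 5.3 of the proof of Thm. 4.1.** [cite: LiYang2022, §4.1 (Case 5.3)] -/
theorem LiYang2022_case5_3_holds : LiYang2022_case5_3 := by
  intro αφ αI αQ hφ0 hφ hI hQ n d f hf C R hF hC hd hS G x y B C' D aX aB aC aD hcfg hextra
  obtain ⟨hBC, -, ⟨aCD, hCD⟩, ⟨aDB, hDB⟩⟩ := hextra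
  classical
  have hφ' := hφ0.le
  have hI' := hI.le
  set E₁ := case5E₁ hf hd hF hC hS hcfg hφ' hI' αQ with hE₁
  set E₂ := case5E₂ hf hd hF hC hS hcfg hφ' hI' αQ with hE₂
  set E₃ := case5E₃ hf hd hF hC hS hcfg hφ' hI' αQ with hE₃
  -- `D` reads `C'` at `aD.rev`, `B` reads `D` at `aB.rev`
  have haCD : aCD = aD.rev := by
    rcases fin2_eq_or_eq_rev aD aCD with e | e
    · rw [e, hcfg.arg_D] at hCD; cases hCD; exact absurd rfl hcfg.C_ne_G
    · exact e
  rw [haCD] at hCD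
  have haDB : aDB = aB.rev := by
    rcases fin2_eq_or_eq_rev aB aDB with e | e
    · rw [e, hcfg.arg_B] at hDB; cases hDB
    · exact e
  rw [haDB] at hDB
  -- `C'` along the chain
  obtain ⟨kC₁, hkC₁⟩ := E₁.ι_surj C' hcfg.C_ne_G
  have hkC₁D : kC₁ ≠ case5kD hf hd hF hC hS hcfg hφ' hI' αQ := by
    intro h
    have := congrArg E₁.ι h
    rw [hkC₁, case5kD_spec] at this
    exact case5_C_ne_D hS hcfg this
  obtain ⟨kC₂, hkC₂⟩ := E₂.ι_surj kC₁ hkC₁D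
  have hC₁y : (case5C₁ hcfg).arg C' aC = .var y := by
    rw [case5C₁_arg_of_ne hcfg (by rw [hcfg.arg_C]; exact fun h => hcfg.x_ne_y.symm (Node.var.inj h))]
    exact hcfg.arg_C
  have hkC₁y : E₁.C'.arg kC₁ aC = .var y := by
    rw [E₁.arg_eq_var_iff, hkC₁]; exact Or.inl hC₁y
  have hkC₂y : E₂.C'.arg kC₂ aC = .var y := by
    rw [E₂.arg_eq_var_iff, hkC₂]; exact Or.inl hkC₁y
  -- the other wire of `D` after the elimination of `G` is `C'`
  have hp1 : E₁.pull (.gate C') = .gate kC₁ := by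
    have := E₁.pull_ι kC₁; rw [hkC₁] at this; exact this
  have hp2 : E₂.pull (.gate kC₁) = .gate kC₂ := by
    have := E₂.pull_ι kC₂; rw [hkC₂] at this; exact this
  have hDrev : E₁.C'.arg (case5kD hf hd hF hC hS hcfg hφ' hI' αQ) aD.rev = .gate kC₁ := by
    rw [case5_arg_kD_rev, hCD, hp1]
  refine case5_main hf hd hF hC hS hcfg hφ' hI' αQ (fun T hT' => ?_) (fun T hT' => ?_)
  · -- the elimination of `D` introduces no troubled gate
    by_contra hT
    obtain ⟨a, ha⟩ := E₂.causedBy_of_new_troubled T hT' hT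
    rcases fin2_eq_or_eq_rev aD a with e | e
    · rw [e, case5_arg_kD] at ha; exact not_causedBy_const ha
    · rw [e, hDrev] at ha
      rcases ha with ha | ⟨z, hz, -⟩
      · have hT₂ : E₂.ι T = kC₁ := (Node.gate.inj ha).symm
        have hTy : E₂.C'.arg T aC = .var y := by rw [E₂.arg_eq_var_iff, hT₂]; exact Or.inl hkC₁y
        exact case5_not_troubled_of_reads_y₂ hf hd hF hC hS hcfg hφ' hI' αQ hTy hT'
      · cases hz
  · -- the elimination of `B` introduces no troubled gate
    by_contra hT
    obtain ⟨a, ha⟩ := E₃.causedBy_of_new_troubled T hT' hT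
    rcases fin2_eq_or_eq_rev aB a with e | e
    · rw [e, case5_arg_kB] at ha; exact not_causedBy_const ha
    · -- the other wire of `B` is `D`, replaced by the replacement node of `D`
      have hB₁ : E₁.C'.arg (case5kB₁ hf hd hF hC hS hcfg hφ' hI' αQ) aB.rev = .gate (case5kD hf hd hF hC hS hcfg hφ' hI' αQ) := by
        rw [E₁.arg_eq_gate_iff, case5kB₁_spec, case5kD_spec]
        refine Or.inl ?_
        rw [case5C₁_arg_of_ne hcfg (by rw [hDB]; exact fun h => by cases h)]; exact hDB
      have hB₂ : E₂.C'.arg (case5kB hf hd hF hC hS hcfg hφ' hI' αQ) aB.rev = E₂.pull E₂.repl := by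
        rw [E₂.arg_eq', case5kB_spec, hB₁, if_pos rfl]
      rw [e, hB₂] at ha
      rcases case5E₂_repl_cases hf hd hF hC hS hcfg hφ' hI' αQ with ⟨b, hb⟩ | hr
      · rw [show E₂.repl = .const b from hb, show E₂.pull (.const b) = .const b from E₂.pull_embed (.const b)] at ha
        exact not_causedBy_const ha
      · rw [show E₂.repl = E₁.pull (C.arg D aD.rev) from hr, hCD, hp1, hp2] at ha
        rcases ha with ha | ⟨z, hz, -⟩
        · have hT₃ : E₃.ι T = kC₂ := (Node.gate.inj ha).symm
          have hTy : E₃.C'.arg T aC = .var y := by rw [E₃.arg_eq_var_iff, hT₃]; exact Or.inl hkC₂y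
          exact case5_not_troubled_of_reads_y₃ hf hd hF hC hS hcfg hφ' hI' αQ hBC hTy hT'
        · cases hz

end Literature.Computability.Complexity
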